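import Literature.IUT.HodgeTheaters.GlobalFrobenioidsCoricModel
import HarnessLib

/-!
# [IUTchI] Example 5.1 (v), the "does NOT factor through `π₁^{κ-sol}`" input `hmoves`:
# reduction to the constants

Mochizuki, *Inter-universal Teichmüller theory I*, §5, Example 5.1 (v), kurims manuscript
(May 2020) p. 127 l. 30–35 ("(respectively, does not factor)") with (i) p. 124 (the constants are
`∞κ×`-coric) and Remark 3.1.7 (ii)–(iii) (`L_C(κ-sol) ⊊ L̄_C`). [claim: Mochizuki2012, status: disputed]

PROOF-ONLY companion (no `def`, no `instance`, no `structure`; nothing of abc-iut-L5-t1's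
`GlobalFrobenioids.lean` is edited or restated) for SUBDAG-IUTchI-Ex51 row **E51/L23**.  The row's
closer `NFBridgeRecon.IsCoricStructure.not_factorsThrough_ratKsolKer`
(`GlobalFrobenioidsCoricModel.lean`, abc-iut-w5-d110) keeps the printed input as the explicit
hypothesis

  `hmoves : ∃ g ∈ N.ratKsolKer, ∃ f ∈ N.Minfκx, g • f ≠ f`

("some element of `π₁^{rat/κ-sol}(†𝒟^⊛)` moves some `∞κ×`-coric rational function").  This file
SPLITS that hypothesis into the frozen FACT-LIST law F-2572 `NFBridgeRecon.ConstantsInfκx`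
("`𝕄^⊛ ⊆ 𝕄^⊛_∞κ×`: the constants are `∞κ×`-coric", p. 124) and a statement about the Galois side
of the datum only:

  (G)  some `g ∈ π₁^rat(†𝒟^⊛)` acting trivially on `𝕄^⊛_∞κ(†𝒟^⊚)` and lying over
       `solKer = Ker(π₁(†𝒟^⊛) ↠ G_{F_mod} ↠ G_{F_mod}^{sol})` MOVES SOME CONSTANT `x ∈ 𝕄̄^⊛ ≅ F̄`,

namely `hmoves_of_constantsInfκx` : F-2572 ∧ (G) ⟹ `hmoves` (the constant `x`, transported by the
equivariant injection `const : 𝕄̄^⊛ ↪ K_rat` of the datum, is the moved `∞κ×`-coric function), and the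
converse direction restricted to constants, `exists_moved_const_of_hmoves_const`; equivalently, in
the vocabulary of (i) p. 124, `hmoves_of_msol_ne_top` : F-2572 ∧ `𝕄^⊛_sol ≠ 𝕄^⊛` ("`F^×_sol ⊊ F̄^×`")
⟹ `hmoves` (with converse `msol_ne_top_of_moved_const`).  At the GENUINE
datum, (G) is the classical fact "`Ker(G_{F_mod} ↠ G_{F_mod}^{sol}) ≠ 1`" = `F̄ ≠ F^{sol}_{mod}` —
kernel theorems `Literature.NumberTheory.NumberFields.exists_isGalois_not_isSolvable`
(`AbsoluteGaloisGroupNotSolvable.lean`) and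
`Literature.NumberTheory.NumberFields.exists_ne_one_forall_mem_absoluteGaloisGroup`
(`AbsoluteGaloisGroupProsolvableKernel.lean`) — combined with the model identification of
`solKer` and of the action on `𝕄^⊛_∞κ` (a merge item of the genuine `NFBridgeRecon`, not claimed
here).  HONEST LABEL: nothing here constructs the genuine datum or asserts any [IUTchI] statement;
no side is taken on [IUTchIII] Cor. 3.12.
-/

namespace Literature.IUT.HodgeTheaters

namespace NFBridgeRecon

universe u

variable (N : NFBridgeRecon.{u})

/-- **E51/L23 split.**  If the constants are `∞κ×`-coric (F-2572 `ConstantsInfκx`, p. 124) and some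
`g ∈ π₁^rat(†𝒟^⊛)` that acts trivially on `𝕄^⊛_∞κ(†𝒟^⊚)` and lies over `solKer` moves a nonzero
constant `x ∈ 𝕄̄^⊛`, then `g ∈ π₁^{rat/κ-sol}(†𝒟^⊛)` moves the `∞κ×`-coric function `const x` — the
hypothesis `hmoves` of `IsCoricStructure.not_factorsThrough_ratKsolKer` (Ex. 5.1 (v) p. 127,
"does not factor").  PROVED (equivariance and injectivity of `const`).
([IUTchI] Ex 5.1 (v) p.127) [claim: Mochizuki2012, status: disputed] -/
theorem hmoves_of_constantsInfκx (hc : N.ConstantsInfκx)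
    (h : ∃ g : N.piRat, g ∈ N.actionKer ∧ N.ratToAst g ∈ N.solKer ∧
      ∃ x : N.Fbar, x ≠ 0 ∧ N.ratToAst g • x ≠ x) :
    ∃ g ∈ N.ratKsolKer, ∃ f ∈ N.Minfκx, g • f ≠ f := by
  obtain ⟨g, hga, hgs, x, hx0, hgx⟩ := h
  refine ⟨g, Subgroup.mem_inf.mpr ⟨hga, ?_⟩, N.const x, ?_, ?_⟩
  · exact Subgroup.mem_comap.mpr hgs
  · exact hc.mem (Units.mk0 x hx0)
  · intro hfix
    apply hgx
    apply N.const.injective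
    rw [N.const_smul, hfix]

/-- Conversely (restricted to constants): if some `g ∈ π₁^{rat/κ-sol}(†𝒟^⊛)` moves a CONSTANT
`∞κ×`-coric function `const x`, then `g` acts trivially on `𝕄^⊛_∞κ`, lies over `solKer`, and moves the
nonzero constant `x` — so on the constants the split of `hmoves_of_constantsInfκx` loses nothing.
PROVED (definition of `π₁^{rat/κ-sol}` as `actionKer ⊓ solKer`-preimage, p. 124, and equivariance
of `const`). ([IUTchI] Ex 5.1 (i) p.124) [claim: Mochizuki2012, status: disputed] -/
theorem exists_moved_const_of_hmoves_const
    (h : ∃ g ∈ N.ratKsolKer, ∃ x : N.Fbar, g • N.const x ≠ N.const x) :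
    ∃ g : N.piRat, g ∈ N.actionKer ∧ N.ratToAst g ∈ N.solKer ∧
      ∃ x : N.Fbar, x ≠ 0 ∧ N.ratToAst g • x ≠ x := by
  obtain ⟨g, hg, x, hgx⟩ := h
  have hg' := Subgroup.mem_inf.mp hg
  refine ⟨g, hg'.1, Subgroup.mem_comap.mp hg'.2, x, ?_, ?_⟩
  · rintro rfl
    apply hgx
    rw [map_zero, smul_zero]
  · intro hfix
    apply hgx
    rw [← N.const_smul, hfix]

/-- The two halves together: GIVEN F-2572 `ConstantsInfκx`, the printed input `hmoves` holds as soon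
as some element of `π₁^rat(†𝒟^⊛)` acting trivially on `𝕄^⊛_∞κ` and lying over
`Ker(π₁(†𝒟^⊛) ↠ G_{F_mod}^{sol})` moves a nonzero constant; this is the form in which the classical
fact "`F^{sol}_{mod} ≠ F̄`" (tree: `Literature.NumberTheory.NumberFields.exists_isGalois_not_isSolvable`,
`…exists_ne_one_forall_mem_absoluteGaloisGroup`) enters Ex. 5.1 (v) at the genuine datum.
Restatement of `hmoves_of_constantsInfκx` with the mover packaged over `𝕄^⊛ = 𝕄̄^⊛ ∖ {0}` (units).
([IUTchI] Ex 5.1 (v) p.127) [claim: Mochizuki2012, status: disputed] -/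
theorem hmoves_of_constantsInfκx_units (hc : N.ConstantsInfκx)
    (h : ∃ g : N.piRat, g ∈ N.actionKer ∧ N.ratToAst g ∈ N.solKer ∧
      ∃ x : N.Mast, N.ratToAst g • (x : N.Fbar) ≠ x) :
    ∃ g ∈ N.ratKsolKer, ∃ f ∈ N.Minfκx, g • f ≠ f := by
  obtain ⟨g, hga, hgs, x, hgx⟩ := h
  exact N.hmoves_of_constantsInfκx hc ⟨g, hga, hgs, (x : N.Fbar), x.ne_zero, hgx⟩

/-- **`𝕄^⊛_sol ⊊ 𝕄^⊛` suffices.**  In the notation of Ex. 5.1 (i) p. 124 (`𝕄^⊛_sol(†𝒟^⊚)` = the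
`π₁^{rat/κ-sol}`-invariants of `𝕄^⊛`, "`F^×_sol ⊆ F̄^×`", abc-iut-L5-t1's `NFBridgeRecon.Msol`): if the
constants are `∞κ×`-coric (F-2572) and `𝕄^⊛_sol ≠ 𝕄^⊛` — i.e. SOME constant is moved by
`π₁^{rat/κ-sol}(†𝒟^⊛)`, the datum-level shadow of the classical "`F^{sol} ≠ F̄`"
(`Literature.NumberTheory.NumberFields.exists_isGalois_not_isSolvable`) — then `hmoves` holds.
PROVED. ([IUTchI] Ex 5.1 (v) p.127) [claim: Mochizuki2012, status: disputed] -/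
theorem hmoves_of_msol_ne_top (hc : N.ConstantsInfκx) (h : N.Msol ≠ ⊤) :
    ∃ g ∈ N.ratKsolKer, ∃ f ∈ N.Minfκx, g • f ≠ f := by
  obtain ⟨x, hx⟩ : ∃ x : N.Mast, x ∉ N.Msol := by
    by_contra h'
    exact h (eq_top_iff.mpr fun x _ => by_contra fun hx => h' ⟨x, hx⟩)
  have hx' : ¬ ∀ g ∈ N.ratKsolKer, N.ratToAst g • (x : N.Fbar) = x := hx
  push Not at hx'
  obtain ⟨g, hg, hgx⟩ := hx'
  refine ⟨g, hg, N.const x, hc.mem x, fun hfix => hgx (N.const.injective ?_)⟩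
  rw [N.const_smul, hfix]

/-- Conversely, a constant `∞κ×`-coric function moved by `π₁^{rat/κ-sol}(†𝒟^⊛)` exhibits
`𝕄^⊛_sol ≠ 𝕄^⊛`. PROVED. ([IUTchI] Ex 5.1 (i) p.124) [claim: Mochizuki2012, status: disputed] -/
theorem msol_ne_top_of_moved_const
    (h : ∃ g ∈ N.ratKsolKer, ∃ x : N.Mast, g • N.const (x : N.Fbar) ≠ N.const x) :
    N.Msol ≠ ⊤ := by
  obtain ⟨g, hg, x, hgx⟩ := h
  intro htop
  have hx : x ∈ N.Msol := htop ▸ Subgroup.mem_top x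
  have hfix : N.ratToAst g • (x : N.Fbar) = x := hx g hg
  exact hgx (by rw [← N.const_smul, hfix])

/-- **E51/L23 closer, reduced form.**  "The `π₁^rat(†𝒟^⊛)`-action that appears in an `∞κ×`-coric
structure does NOT factor through `π₁^rat(†𝒟^⊛) ↠ π₁^{κ-sol}(†𝒟^⊛)`" (Ex. 5.1 (v), p. 127 l. 30–35) for
every `∞κ×`-coric structure `P` on `†ℱ^⊛`, from the frozen law F-2572 (`ConstantsInfκx`, p. 124) and
`𝕄^⊛_sol ≠ 𝕄^⊛` alone — abc-iut-w5-d110's `IsCoricStructure.not_factorsThrough_ratKsolKer` with its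
hypothesis `hmoves` discharged by `hmoves_of_msol_ne_top`.  PROVED as a reduction; `𝕄^⊛_sol ≠ 𝕄^⊛`
is the datum-level form of the classical `F^{sol} ≠ F̄`. ([IUTchI] Ex 5.1 (v) p.127)
[claim: Mochizuki2012, status: disputed] -/
theorem IsCoricStructure.not_factorsThrough_of_msol_ne_top {P : CoricPair N.piRat}
    (h : IsCoricStructure N.piRat N.infκxPair P) (hc : N.ConstantsInfκx) (hM : N.Msol ≠ ⊤) :
    ¬ P.FactorsThrough N.ratKsolKer :=
  IsCoricStructure.not_factorsThrough_ratKsolKer N h (N.hmoves_of_msol_ne_top hc hM)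

end NFBridgeRecon

end Literature.IUT.HodgeTheaters
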